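import Summits.ResolutionOfSingularities.ResolutionOfSingularities.Theorems.WeightedInvariantHypersurfaceCentreAssemblyPointDict
import Summits.ResolutionOfSingularities.ResolutionOfSingularities.Theorems.WeightedInvariantHypersurfaceCentreAssemblyChartBridge
import Literature.AlgebraicGeometry.Resolution.CotangentIndependenceSpread
import Literature.AlgebraicGeometry.Resolution.SmoothStalksRegular
import Literature.AlgebraicGeometry.Resolution.Principalization
import HarnessLib

/-!
# Door assembly H2c″, stub [S4] — the canonical centre is a regular weighted centre, from the ∀-model open presentation

Route `ResolutionOfSingularities/WeightedInvariant`, crux `Theses.WeightedInvariant.HypersurfaceCentreConstruction`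
(stmt-ResolutionOfSingularities-19897), door line `local-engine`, skeleton v3 → v3.1, stub [S4]
`stub_isRegularWeightedCentre_of_isCanonicalCentre` (res-L1-w43-stub-9 = res-D-brk-1). CONTENT of [S4] modulo the closedness of
the maximum locus ([S1], res-type-057): `isRegularWeightedCentre_of_isCanonicalCentre_of_forallPresentation`. Hypothesis
`hopen` is the body, VERBATIM, of the (c9′-open″) clause `JOpenPresentationForallSing p ι J` (TP5′+TP5″, registrar's
`eft4s_defs_draft_v1.lean` cce9959cf0da27c6; the by-name closer passes the tree constant once module `…LocalGameEFT4S` lands).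

Proof. At `y` on the maximum locus pick an affine `U₀ ∋ y` with `X(U₀) = (F)` (`IsLocallyPrincipal`); the model is
`(A, 𝔪, F) = (Γ(Y,U₀), 𝔮_y, F)`: `A_𝔪 ≅ 𝒪_{Y,y}` is regular (`Y` smooth), `F/1 ≠ 0` and `F/1 ∈ 𝔪²` because `y ∈ singImage X`
(point dictionary p·PointDict). The clause returns `h ∉ 𝔪` and a positively weighted system `(U, W)` independent at `𝔪`,
stratum-exact and presenting `J` on `D(h)`. After cutting away the irreducible components of `U₀` missing `y`
(`exists_not_mem_forall_algebraMap_ne_zero`: `F/1 ≠ 0` on `D(h')`), on `D(h h')` the model stratum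
«`F/1 ∈ 𝔪_{𝔮}² ∧ ι(A_𝔮, F) = ι(A_𝔪, F)`» IS the maximum locus (`mem_singImage_iff_algebraMap_mem_sq`, `iotaAt_eq_iota_localization`),
so the bridge `exists_chart_of_presentation` (p504102) yields a weighted chart at `y`, and `isRegularWeightedCentre_of_isCanonicalCentre_of_charts`
(p502377) concludes. OURS; no claim about Hironaka's problem. [cite: Wlodarczyk2022, 2.1.10]
-/

noncomputable section

set_option linter.dupNamespace false -- mandated namespace of this single-conjunct summit

open CategoryTheory AlgebraicGeometry TopologicalSpace IsLocalRing
open Literature.AlgebraicGeometry.Resolution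
open Summit.ResolutionOfSingularities.ResolutionOfSingularities.Theorems

namespace Summit.ResolutionOfSingularities.ResolutionOfSingularities.Cruxes.HypersurfaceCentreConstruction.LocalEngine

variable (ι : (R : Type) → [CommRing R] → R → Ordinal.{0}) (J : (R : Type) → [CommRing R] → R → ℕ → Ideal R)

/-- **[S4] modulo [S1]: the canonical centre of a hypersurface pair is a regular weighted centre**, given (c6), (c12a) for `ι`
and `J`, iso-invariance of `J`, the ∀-MODEL STRATUM-EXACT OPEN PRESENTATION clause (open″) (`hopen`, the body of
`JOpenPresentationForallSing p ι J` verbatim), `f : Y → Spec k` smooth over a perfect field of characteristic `p`, `X` locally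
principal, `R` a canonical centre of `(Y, X)` and the maximum locus closed. [cite: Wlodarczyk2022, 2.1.10] -/
theorem isRegularWeightedCentre_of_isCanonicalCentre_of_forallPresentation {p : ℕ}
    (hc6 : IotaIsoInvariant ι) (hu : IotaUnitInvariant ι) (hJ : JIsoInvariant J) (hJu : JUnitInvariant J)
    (hopen : ∀ (k₀ : Type) [Field k₀] [CharP k₀ p] [PerfectField k₀]
      (A : Type) [CommRing A] [Algebra k₀ A] [Algebra.FiniteType k₀ A] (𝔪 : Ideal A) [𝔪.IsPrime] (F : A),
      IsRegularLocalRing (Localization.AtPrime 𝔪) →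
      algebraMap A (Localization.AtPrime 𝔪) F ≠ 0 →
      algebraMap A (Localization.AtPrime 𝔪) F ∈ (maximalIdeal (Localization.AtPrime 𝔪)) ^ 2 →
      ∃ h : A, h ∉ 𝔪 ∧ ∃ (N : ℕ) (U : Fin N → A) (W : Fin N → ℕ), (∀ i, 0 < W i) ∧
        (∃ hU : ∀ i, algebraMap A (Localization.AtPrime 𝔪) (U i) ∈ maximalIdeal (Localization.AtPrime 𝔪),
          LinearIndependent (ResidueField (Localization.AtPrime 𝔪))
            (fun i => ((maximalIdeal (Localization.AtPrime 𝔪)).toCotangent ⟨_, hU i⟩ :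
              CotangentSpace (Localization.AtPrime 𝔪)))) ∧
        ∀ (𝔮 : Ideal A) [𝔮.IsPrime], h ∉ 𝔮 →
          ((∀ i, U i ∈ 𝔮) ↔
            (algebraMap A (Localization.AtPrime 𝔮) F ∈ (maximalIdeal (Localization.AtPrime 𝔮)) ^ 2 ∧
              ι (Localization.AtPrime 𝔮) (algebraMap A (Localization.AtPrime 𝔮) F) =
                ι (Localization.AtPrime 𝔪) (algebraMap A (Localization.AtPrime 𝔪) F))) ∧
          ((∀ i, U i ∈ 𝔮) → ∀ m : ℕ,
            J (Localization.AtPrime 𝔮) (algebraMap A (Localization.AtPrime 𝔮) F) m =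
              (weightedMonomialIdeal U W m).map (algebraMap A (Localization.AtPrime 𝔮))))
    {k : Type} [Field k] [CharP k p] [PerfectField k] {Y : Scheme.{0}} (f : Y ⟶ Spec (.of k)) [Smooth f]
    (X : Y.IdealSheafData) (hX : IsLocallyPrincipal X) (R : ReesAlgebraData Y) (hR : IsCanonicalCentre ι J X R)
    (hM : IsClosed (maxLocus ι X)) : R.IsRegularWeightedCentre := by
  classical
  haveI : IsLocallyNoetherian Y := LocallyOfFiniteType.isLocallyNoetherian f
  refine isRegularWeightedCentre_of_isCanonicalCentre_of_charts ι J f hR hM fun y hyM => ?_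
  have hys : y ∈ singImage X := hyM.1
  -- an affine chart with a local equation
  obtain ⟨U₀, hyU₀, F, hF⟩ := hX y
  -- the model `(A, 𝔪, F) = (Γ(Y, U₀), 𝔮_y, F)`, of finite type over `k`
  have hft : RingHom.FiniteType (f.appLE ⊤ U₀ le_top).hom :=
    HasRingHomProperty.appLE @LocallyOfFiniteType f inferInstance ⟨⊤, isAffineOpen_top _⟩ U₀ le_top
  let φ : k →+* Γ(Y, U₀) := (f.appLE ⊤ U₀ le_top).hom.comp (Scheme.ΓSpecIso (.of k)).inv.hom
  have hφ : φ.FiniteType :=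
    hft.comp (RingHom.FiniteType.of_surjective _
      (Scheme.ΓSpecIso (.of k)).commRingCatIsoToRingEquiv.symm.surjective)
  letI : Algebra k Γ(Y, U₀) := φ.toAlgebra
  haveI : Algebra.FiniteType k Γ(Y, U₀) := hφ
  set 𝔪 := (U₀.2.primeIdealOf ⟨y, hyU₀⟩).asIdeal with h𝔪
  haveI h𝔪p : 𝔪.IsPrime := (U₀.2.primeIdealOf ⟨y, hyU₀⟩).isPrime
  haveI : IsRegularLocalRing (Y.presheaf.stalk y) := isRegularLocalRing_stalk_of_smooth_of_field f y
  haveI hreg𝔪 : IsRegularLocalRing (Localization.AtPrime 𝔪) :=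
    IsRegularLocalRing.of_ringEquiv (stalkEquiv U₀ hyU₀).symm
  -- the local equation at `y`: non-zero and in `𝔪²`
  have hF0 : algebraMap Γ(Y, U₀) (Localization.AtPrime 𝔪) F ≠ 0 := fun h =>
    germ_ne_zero_of_mem_singImage X U₀ hyU₀ hF hys ((algebraMap_eq_zero_iff_germ_eq_zero U₀ hyU₀ F).mp h)
  have hF2 : algebraMap Γ(Y, U₀) (Localization.AtPrime 𝔪) F ∈ maximalIdeal (Localization.AtPrime 𝔪) ^ 2 :=
    (mem_singImage_iff_algebraMap_mem_sq X U₀ hyU₀ hF hF0).mp hys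
  -- the clause at the model
  obtain ⟨h, hh𝔪, N, U, W, hW, ⟨hU𝔪, hli𝔪⟩, hcl⟩ := hopen k Γ(Y, U₀) 𝔪 F hreg𝔪 hF0 hF2
  -- cut away the components missing `y`: `F/1 ≠ 0` on `D(h')`
  haveI : IsNoetherianRing Γ(Y, U₀) := IsLocallyNoetherian.component_noetherian U₀
  haveI : IsDomain (Localization.AtPrime 𝔪) := isDomain_of_isRegularLocalRing _
  obtain ⟨h', hh'𝔪, hF0'⟩ := exists_not_mem_forall_algebraMap_ne_zero 𝔪 hF0
  have hhh' : h * h' ∉ 𝔪 := fun hmem => (h𝔪p.mem_or_mem hmem).elim hh𝔪 hh'𝔪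
  have hyD : y ∈ Y.basicOpen (h * h') := (mem_basicOpen_iff_not_mem U₀ hyU₀ (h * h')).mpr hhh'
  -- the system at `y`, read in the stalk
  have hUy : ∀ i, (Y.presheaf.germ (U₀ : Y.Opens) y hyU₀).hom (U i) ∈ maximalIdeal (Y.presheaf.stalk y) := fun i =>
    (germ_mem_maximalIdeal_iff_mem U₀ hyU₀ (U i)).mpr
      ((IsLocalization.AtPrime.to_map_mem_maximal_iff (Localization.AtPrime 𝔪) 𝔪 (U i)).mp (hU𝔪 i))
  have hex : ∀ i, stalkEquiv U₀ hyU₀ (algebraMap Γ(Y, U₀) (Localization.AtPrime 𝔪) (U i)) ∈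
      maximalIdeal (Y.presheaf.stalk y) := fun i => by
    rw [stalkEquiv_algebraMap]
    exact hUy i
  have hliy : LinearIndependent (ResidueField (Y.presheaf.stalk y))
      fun i => (maximalIdeal (Y.presheaf.stalk y)).toCotangent ⟨_, hUy i⟩ := by
    have h1 := linearIndependent_toCotangent_map_ringEquiv (stalkEquiv U₀ hyU₀) _ hU𝔪 hli𝔪 hex
    convert h1 using 3 with i
    exact Subtype.ext (stalkEquiv_algebraMap U₀ hyU₀ (U i)).symm
  -- `ι_max = ι(A_𝔪, F/1)`
  have hmax : iotaMax ι X = ι (Localization.AtPrime 𝔪) (algebraMap Γ(Y, U₀) (Localization.AtPrime 𝔪) F) := by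
    rw [← hyM.2]
    exact iotaAt_eq_iota_localization ι (hy := hyU₀) f hc6 hu X hF
  -- on `D(h h')` the model stratum is the maximum locus
  have hconv : ∀ (y' : Y) (hy' : y' ∈ (U₀ : Y.Opens)), y' ∈ Y.basicOpen (h * h') →
      ((algebraMap Γ(Y, U₀) (Localization.AtPrime (U₀.2.primeIdealOf ⟨y', hy'⟩).asIdeal) F ∈
          maximalIdeal (Localization.AtPrime (U₀.2.primeIdealOf ⟨y', hy'⟩).asIdeal) ^ 2 ∧
        ι (Localization.AtPrime (U₀.2.primeIdealOf ⟨y', hy'⟩).asIdeal)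
          (algebraMap Γ(Y, U₀) (Localization.AtPrime (U₀.2.primeIdealOf ⟨y', hy'⟩).asIdeal) F) =
          ι (Localization.AtPrime 𝔪) (algebraMap Γ(Y, U₀) (Localization.AtPrime 𝔪) F)) ↔
        y' ∈ maxLocus ι X) := by
    intro y' hy' hy'D
    have hhh'y' : h * h' ∉ (U₀.2.primeIdealOf ⟨y', hy'⟩).asIdeal := (mem_basicOpen_iff_not_mem U₀ hy' (h * h')).mp hy'D
    have hh'y' : h' ∉ (U₀.2.primeIdealOf ⟨y', hy'⟩).asIdeal := fun hm => hhh'y' (Ideal.mul_mem_left _ h hm)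
    haveI : IsRegularLocalRing (Y.presheaf.stalk y') := isRegularLocalRing_stalk_of_smooth_of_field f y'
    have h0' := hF0' (U₀.2.primeIdealOf ⟨y', hy'⟩).asIdeal hh'y'
    rw [← mem_singImage_iff_algebraMap_mem_sq X U₀ hy' hF h0', ← iotaAt_eq_iota_localization ι (hy := hy') f hc6 hu X hF,
      ← hmax]
    rfl
  -- the bridge
  refine exists_chart_of_presentation ι J f hJ hJu hR U₀ hyU₀ hF (h * h') hyD U W hW hUy hliy ?_ ?_
  · -- stratum exactness on `D(h h')`
    intro y' hy' hy'D
    have hhh'y' : h * h' ∉ (U₀.2.primeIdealOf ⟨y', hy'⟩).asIdeal := (mem_basicOpen_iff_not_mem U₀ hy' (h * h')).mp hy'D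
    have hhy' : h ∉ (U₀.2.primeIdealOf ⟨y', hy'⟩).asIdeal := fun hm => hhh'y' (Ideal.mul_mem_right h' _ hm)
    rw [← hconv y' hy' hy'D, ← (hcl (U₀.2.primeIdealOf ⟨y', hy'⟩).asIdeal hhy').1]
    exact forall_congr' fun i => germ_mem_maximalIdeal_iff_mem U₀ hy' (U i)
  · -- presentation on the maximum locus
    intro y' hy' hy'D hy'M m
    have hhh'y' : h * h' ∉ (U₀.2.primeIdealOf ⟨y', hy'⟩).asIdeal := (mem_basicOpen_iff_not_mem U₀ hy' (h * h')).mp hy'D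
    have hhy' : h ∉ (U₀.2.primeIdealOf ⟨y', hy'⟩).asIdeal := fun hm => hhh'y' (Ideal.mul_mem_right h' _ hm)
    exact (hcl (U₀.2.primeIdealOf ⟨y', hy'⟩).asIdeal hhy').2
      (((hcl (U₀.2.primeIdealOf ⟨y', hy'⟩).asIdeal hhy').1).mpr ((hconv y' hy' hy'D).mpr hy'M)) m

end Summit.ResolutionOfSingularities.ResolutionOfSingularities.Cruxes.HypersurfaceCentreConstruction.LocalEngine

end
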